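import Mathlib.Analysis.SpecialFunctions.Pow.Integral
import Literature.Analysis.FunctionSpaces.FourierSobolevNorm
import Literature.Analysis.FunctionSpaces.PlancherelL1L2
import HarnessLib

/-!
# The critical Sobolev embedding `Ḣ^{1/2}(ℝ³) ⊂ L³(ℝ³)`: discharge of
`eLpNorm_three_le_eHomSobolevSeminorm_half`

Topic `Analysis/FunctionSpaces`; sibling proof file of `FourierSobolevNorm.lean` (which stays
untouched; D-0014: a named fact `def X : Prop` is discharged as `theorem X_holds : X`). It
**proves**

* `Literature.eLpNorm_three_le_eHomSobolevSeminorm_half_holds : eLpNorm_three_le_eHomSobolevSeminorm_half`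
  — there is a constant `C` such that `‖f‖_{L³(ℝ³)} ≤ C ‖f‖_{Ḣ^{1/2}(ℝ³)}` for every
  `f ∈ L²(ℝ³; F)` (`F` any complex Hilbert space), where `‖f‖_{Ḣ^{1/2}}² = ∫ ‖ξ‖ ‖𝓕f(ξ)‖² dξ`
  is the Fourier-side homogeneous seminorm `Function.eHomSobolevSeminorm (1/2)` of
  `FourierSobolevNorm.lean` (Bahouri–Chemin–Danchin 2011, Def. 1.31) and the statement is
  Bahouri–Chemin–Danchin 2011, Thm. 1.38 with `d = 3`, `s = 1/2`, `p = 2d/(d - 2s) = 3`.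

The constant obtained is `C = (24 J₁^{1/2})^{1/3}` with `J₁ = ∫_{‖ξ‖<1} ‖ξ‖⁻¹ dξ` (`= 2π`, not
evaluated here).

## Source and proof

The statement is the case `d = 3`, `s = 1/2`, `p = 3` of the classical Sobolev inequality
`‖f‖_{L^p} ≤ C_s ‖f‖_{Ḣ^s}`, `p = 2d/(d-2s)`, `0 ≤ s < d/2`, which the tree cites as
Bahouri–Chemin–Danchin 2011, Thm. 1.38 (book not held by the literature store) and which is
inequality (5) of the Introduction of Chemin–Xu (Ann. Sci. ÉNS (4) 30 (1997), held and read: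
pp. 722–724). The proof formalised is the frequency-splitting proof given there ((8)–(10),
"une méthode issue de l'interpolation réelle"): write `f = f_{1,A} + f_{2,A}` with
`f_{1,A} = 𝓕⁻¹(1_{B(0,A)} 𝓕f)` ((8) loc. cit.); by Cauchy–Schwarz `‖f_{1,A}‖_{L^∞} ≤ ‖1_{B(0,A)} 𝓕f‖_{L¹} ≤ (∫_{B(0,A)} ‖ξ‖^{-2s})^{1/2}
‖f‖_{Ḣ^s} = C A^{d/2-s} ‖f‖_{Ḣ^s}` ((9) loc. cit.); by the layer-cake formula
`‖f‖_{L^p}^p = p ∫₀^∞ λ^{p-1} |{‖f‖ > λ}| dλ`, and choosing `A = A_λ` with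
`‖f_{1,A_λ}‖_∞ ≤ λ/2`, one has `{‖f‖ > λ} ⊂ {‖f_{2,A_λ}‖ > λ/2}`, whose measure is at most
`4 λ⁻² ‖f_{2,A_λ}‖_{L²}² = 4 λ⁻² ∫_{‖ξ‖ ≥ A_λ} ‖𝓕f‖²` (Bienaymé–Chebyshev and Plancherel, (10)
loc. cit.); Fubini–Tonelli in `(λ, ξ)` then gives `‖f‖_{L^p}^p ≤ C ‖f‖_{Ḣ^s}^{p-2} ∫ ‖ξ‖^{2s}
‖𝓕f‖² = C ‖f‖_{Ḣ^s}^p`. Here `d = 3`, `s = 1/2`, `p = 3`, and the bookkeeping is done with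
`ℝ≥0∞`-valued integrals:

1. (`SobolevEmbeddingHalf.fourierInv_toLp_ae_eq_fourierIntegralInv`) Mathlib's `L²` inverse
   Fourier transform of an `L¹ ∩ L²` function agrees a.e. with the inverse Fourier integral
   (both are the inverse transform of the same tempered distribution,
   `MeasureTheory.Lp.fourierInv_toTemperedDistribution_eq`; the `𝓕` version is the tree's
   `Literature.Analysis.FunctionSpaces.fourier_toLp_ae_eq_fourierIntegral`, `PlancherelL1L2.lean`), whence the `L^∞` bound on
   the low-frequency part (`SobolevEmbeddingHalf.enorm_fourierInv_toLp_le`) and the splitting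
   `SobolevEmbeddingHalf.exists_high_frequency_part` with Plancherel (`Lp.norm_fourier_eq`) for
   the high-frequency part;
2. (`SobolevEmbeddingHalf.volume_norm_gt_le`) the Bienaymé–Chebyshev step (Mathlib
   `meas_ge_le_lintegral_div`);
3. (`SobolevEmbeddingHalf.lintegral_Ioi_lintegral_compl_ball`,
   `SobolevEmbeddingHalf.lintegral_enorm_rpow_three_le`) Tonelli (`lintegral_lintegral_swap`)
   and the layer-cake formula (`lintegral_rpow_eq_lintegral_meas_lt_mul`);
4. (`SobolevEmbeddingHalf.lintegral_ball_inv_enorm_eq`, `…unitBall…_ne_top`, `…_pos`,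
   `SobolevEmbeddingHalf.lintegral_ball_enorm_le`) in dimension `3`:
   `∫_{B(0,A)} ‖ξ‖⁻¹ dξ = A² J₁` with `0 < J₁ < ∞` (scaling of Lebesgue measure,
   `Measure.map_addHaar_smul`; integrability from `integrableOn_ball_of_norm_le_rpow`) and the
   Cauchy–Schwarz bound `∫_{B(0,A)} ‖𝓕f‖ ≤ A J₁^{1/2} ‖f‖_{Ḣ^{1/2}}`
   (`ENNReal.lintegral_mul_le_Lp_mul_Lq`);
5. (`SobolevEmbeddingHalf.eLpNorm_three_le_const_mul`) assembly for an `L²` class, with the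
   degenerate cases `‖f‖_{Ḣ^{1/2}} = 0` (then `𝓕f = 0`, so `f = 0`) and `= ∞` treated apart.

No new definitions. Namespace `Literature.SobolevEmbeddingHalf` for the auxiliary lemmas; the
discharge itself is `Literature.Analysis.FunctionSpaces.eLpNorm_three_le_eHomSobolevSeminorm_half_holds`.

## References

* [BahouriCheminDanchin2011] H. Bahouri, J.-Y. Chemin, R. Danchin, *Fourier Analysis and
  Nonlinear Partial Differential Equations*, Grundlehren 343, Springer (2011), Def. 1.31,
  Thm. 1.38.
* [CheminXu1997] J.-Y. Chemin, C.-J. Xu, *Inclusions de Sobolev en calcul de Weyl–Hörmander et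
  champs de vecteurs sous-elliptiques*, Ann. Sci. École Norm. Sup. (4) 30 (1997) 719–751,
  doi:10.1016/s0012-9593(97)89937-5, Introduction pp. 722–724, (5), (8)–(10).
-/

noncomputable section

open MeasureTheory SchwartzMap FourierTransform Complex Set Filter
open scoped ENNReal NNReal Topology Real

namespace Literature.Analysis.FunctionSpaces

namespace SobolevEmbeddingHalf

/-! ## The `L²` inverse Fourier transform on `L¹ ∩ L²`; frequency splitting -/

section FourierInv

variable {V : Type*} [NormedAddCommGroup V] [InnerProductSpace ℝ V] [FiniteDimensional ℝ V]
  [MeasurableSpace V] [BorelSpace V]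
variable {F : Type*} [NormedAddCommGroup F] [InnerProductSpace ℂ F] [CompleteSpace F]

omit [CompleteSpace F] in
/-- The inverse Fourier integral of an integrable function is continuous (Mathlib
`VectorFourier.fourierIntegral_continuous`, through `Real.fourierInv_eq_fourier_comp_neg`).
[folklore] -/
lemma continuous_fourierIntegralInv {g : V → F} (hg : Integrable g) : Continuous (𝓕⁻ g) := by
  rw [Real.fourierInv_eq_fourier_comp_neg]
  exact continuous_fourierIntegral hg.comp_neg

omit [CompleteSpace F] in
/-- `‖𝓕⁻¹g(x)‖ ≤ ∫ ‖g‖`: the inverse Fourier integral is bounded by the `L¹` norm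
(Chemin–Xu 1997, (9): `‖f_{1,A}‖_{L^∞} ≤ ‖1_{B(0,A)} 𝓕f‖_{L¹}`). [folklore] -/
lemma norm_fourierIntegralInv_le_integral_norm (g : V → F) (x : V) :
    ‖𝓕⁻ g x‖ ≤ ∫ ξ, ‖g ξ‖ := calc
  _ = ‖∫ ξ, 𝐞 (inner ℝ ξ x) • g ξ‖ := by rw [Real.fourierInv_eq]
  _ ≤ ∫ ξ, ‖𝐞 (inner ℝ ξ x) • g ξ‖ := norm_integral_le_integral_norm _
  _ = ∫ ξ, ‖g ξ‖ := by simp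

/-- Self-adjointness of the inverse Fourier integral against a Schwartz function:
`∫ 𝓕⁻¹ψ • g = ∫ ψ • 𝓕⁻¹g` for `g ∈ L¹` (from the tree's `integral_fourier_schwartz_smul_eq`
by the reflection `ξ ↦ -ξ`). [folklore] -/
lemma integral_fourierInv_schwartz_smul_eq (ψ : 𝓢(V, ℂ)) {g : V → F} (hg : Integrable g) :
    ∫ ξ, 𝓕⁻ (ψ : V → ℂ) ξ • g ξ = ∫ x, ψ x • 𝓕⁻ g x := by
  have h1 : ∫ ξ, 𝓕⁻ (ψ : V → ℂ) ξ • g ξ = ∫ ξ, 𝓕 (ψ : V → ℂ) ξ • g (-ξ) := by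
    rw [← integral_neg_eq_self (fun ξ => 𝓕 (ψ : V → ℂ) ξ • g (-ξ)) volume]
    refine integral_congr_ae (Eventually.of_forall fun ξ => ?_)
    simp only [Real.fourierInv_eq_fourier_neg, neg_neg]
  rw [h1, integral_fourier_schwartz_smul_eq ψ hg.comp_neg, Real.fourierInv_eq_fourier_comp_neg]

/-- **The `L²` inverse Fourier transform agrees with the inverse Fourier integral on
`L¹ ∩ L²`** (the `𝓕⁻¹` companion of the tree's `Literature.Analysis.FunctionSpaces.fourier_toLp_ae_eq_fourierIntegral`):
both are the inverse transform of the same tempered distribution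
(`Lp.fourierInv_toTemperedDistribution_eq`), and locally integrable functions with equal
integrals against test functions agree a.e. (`ae_eq_of_integral_contDiff_smul_eq`).
[folklore] -/
theorem fourierInv_toLp_ae_eq_fourierIntegralInv {g : V → F} (h1 : Integrable g) (h2 : MemLp g 2) :
    ((𝓕⁻ (h2.toLp g) : Lp F 2 (volume : Measure V)) : V → F) =ᵐ[volume] 𝓕⁻ g := by
  set T : Lp F 2 (volume : Measure V) := 𝓕⁻ (h2.toLp g) with hT_def
  have hT : LocallyIntegrable (T : V → F) := (Lp.memLp T).locallyIntegrable (by norm_num)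
  have hFf : LocallyIntegrable (𝓕⁻ g) := (continuous_fourierIntegralInv h1).locallyIntegrable
  refine ae_eq_of_integral_contDiff_smul_eq hT hFf fun θ hθ_smooth hθ_supp ↦ ?_
  have hθc_smooth : ContDiff ℝ (⊤ : ℕ∞) fun x ↦ (θ x : ℂ) := ofRealCLM.contDiff.comp hθ_smooth
  have hθc_supp : HasCompactSupport fun x ↦ (θ x : ℂ) := hθ_supp.comp_left ofReal_zero
  set ψ : 𝓢(V, ℂ) := hθc_supp.toSchwartzMap hθc_smooth with hψ_def
  have hψ : ∀ x, ψ x = (θ x : ℂ) := fun x ↦ rfl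
  have hsmul : ∀ (x : V) (y : F), θ x • y = ψ x • y := fun x y ↦ by
    rw [hψ, Complex.coe_smul]
  calc ∫ x, θ x • (T : V → F) x
      = ∫ x, ψ x • (T : V → F) x := by simp_rw [hsmul]
    _ = (T : 𝓢'(V, F)) ψ := (Lp.toTemperedDistribution_apply T ψ).symm
    _ = (𝓕⁻ ((h2.toLp g : Lp F 2 (volume : Measure V)) : 𝓢'(V, F))) ψ := by
        rw [hT_def, Lp.fourierInv_toTemperedDistribution_eq]
    _ = ((h2.toLp g : Lp F 2 (volume : Measure V)) : 𝓢'(V, F)) (𝓕⁻ ψ) :=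
        TemperedDistribution.fourierInv_apply _ _
    _ = ∫ x, (𝓕⁻ ψ) x • (h2.toLp g : V → F) x := Lp.toTemperedDistribution_apply _ _
    _ = ∫ x, 𝓕⁻ (ψ : V → ℂ) x • g x := by
        refine integral_congr_ae ?_
        filter_upwards [h2.coeFn_toLp] with x hx
        rw [hx, SchwartzMap.fourierInv_coe]
    _ = ∫ x, ψ x • 𝓕⁻ g x := integral_fourierInv_schwartz_smul_eq ψ h1
    _ = ∫ x, θ x • 𝓕⁻ g x := by simp_rw [hsmul]

/-- The `L²` inverse Fourier transform of `g ∈ L¹ ∩ L²` is a.e. bounded by `∫ ‖g‖`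
(Chemin–Xu 1997, (9)). [cite: CheminXu1997, Introduction (9), p. 723] -/
theorem enorm_fourierInv_toLp_le {g : V → F} (h1 : Integrable g) (h2 : MemLp g 2) :
    ∀ᵐ x ∂(volume : Measure V),
      ‖((𝓕⁻ (h2.toLp g) : Lp F 2 (volume : Measure V)) : V → F) x‖ₑ ≤ ∫⁻ ξ, ‖g ξ‖ₑ := by
  filter_upwards [fourierInv_toLp_ae_eq_fourierIntegralInv h1 h2] with x hx
  rw [hx, ← ofReal_integral_norm_eq_lintegral_enorm h1, ← ofReal_norm]
  exact ENNReal.ofReal_le_ofReal (norm_fourierIntegralInv_le_integral_norm g x)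

/-- Plancherel in `∫⁻` form for `L²` classes: `∫ ‖𝓕Ψ‖² = ∫ ‖Ψ‖²` (Mathlib
`MeasureTheory.Lp.norm_fourier_eq`). [folklore] -/
theorem lintegral_enorm_sq_fourier_Lp_eq (Ψ : Lp F 2 (volume : Measure V)) :
    ∫⁻ ξ, ‖((𝓕 Ψ : Lp F 2 (volume : Measure V)) : V → F) ξ‖ₑ ^ 2 = ∫⁻ x, ‖(Ψ : V → F) x‖ₑ ^ 2 := by
  have h : eLpNorm ((𝓕 Ψ : Lp F 2 (volume : Measure V)) : V → F) 2 volume =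
      eLpNorm (Ψ : V → F) 2 volume := by
    rw [← Lp.enorm_def, ← Lp.enorm_def, ← ofReal_norm, ← ofReal_norm, Lp.norm_fourier_eq]
  rw [eLpNorm_eq_lintegral_rpow_enorm_toReal two_ne_zero ENNReal.ofNat_ne_top,
    eLpNorm_eq_lintegral_rpow_enorm_toReal two_ne_zero ENNReal.ofNat_ne_top] at h
  simp only [ENNReal.toReal_ofNat, one_div] at h
  have h' := congrArg (fun x : ℝ≥0∞ ↦ x ^ (2 : ℝ)) h
  simp only [← ENNReal.rpow_mul, show (2 : ℝ)⁻¹ * 2 = 1 by norm_num, ENNReal.rpow_one] at h'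
  simpa [ENNReal.rpow_two] using h'

/-- **Frequency splitting** (Chemin–Xu 1997, (8)–(10)). For `f ∈ L²(V; F)` with `G = 𝓕f` and
a measurable frequency set `s` on which `G` is integrable, `f = f₁ + f₂` a.e. with
`f₁ = 𝓕⁻¹(1_s G)`, `‖f₁‖_{L^∞} ≤ ∫_s ‖G‖`, and `‖f₂‖_{L²}² = ∫_{sᶜ} ‖G‖²` (Plancherel); recorded
as: there is a (strongly measurable) `f₂` with `∫ ‖f₂‖² = ∫_{sᶜ} ‖G‖²` and
`‖f‖ ≤ ∫_s ‖G‖ + ‖f₂‖` a.e. [cite: CheminXu1997, Introduction (8)–(10), pp. 722–724] -/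
theorem exists_high_frequency_part (f₂ : Lp F 2 (volume : Measure V)) {s : Set V}
    (hs : MeasurableSet s)
    (hGs : ∫⁻ ξ in s, ‖((𝓕 f₂ : Lp F 2 (volume : Measure V)) : V → F) ξ‖ₑ < ∞) :
    ∃ fh : V → F, AEStronglyMeasurable fh volume ∧
      ∫⁻ x, ‖fh x‖ₑ ^ 2 = ∫⁻ ξ in sᶜ, ‖((𝓕 f₂ : Lp F 2 (volume : Measure V)) : V → F) ξ‖ₑ ^ 2 ∧
      ∀ᵐ x ∂(volume : Measure V),
        ‖(f₂ : V → F) x‖ₑ ≤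
          (∫⁻ ξ in s, ‖((𝓕 f₂ : Lp F 2 (volume : Measure V)) : V → F) ξ‖ₑ) + ‖fh x‖ₑ := by
  set G : V → F := ((𝓕 f₂ : Lp F 2 (volume : Measure V)) : V → F) with hG_def
  have hGm : AEStronglyMeasurable G volume := Lp.aestronglyMeasurable _
  set gl : V → F := s.indicator G with hgl_def
  have hint : IntegrableOn G s volume := ⟨hGm.restrict, hGs⟩
  have h1 : Integrable gl volume := hint.integrable_indicator hs
  have h2 : MemLp gl 2 (volume : Measure V) := (Lp.memLp _).indicator hs
  set P : Lp F 2 (volume : Measure V) := h2.toLp gl with hP_def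
  set fl : Lp F 2 (volume : Measure V) := 𝓕⁻ P with hfl_def
  set fhL : Lp F 2 (volume : Measure V) := f₂ - fl with hfhL_def
  have hPae : (P : V → F) =ᵐ[volume] gl := h2.coeFn_toLp
  refine ⟨(fhL : V → F), Lp.aestronglyMeasurable _, ?_, ?_⟩
  · have hsub : (𝓕 fhL : Lp F 2 (volume : Measure V)) = 𝓕 f₂ - 𝓕 fl :=
      (Lp.fourierTransformₗᵢ V F).map_sub f₂ fl
    have hF : (𝓕 fhL : Lp F 2 (volume : Measure V)) = 𝓕 f₂ - P := by
      rw [hsub, hfl_def, fourier_fourierInv_eq]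
    rw [← lintegral_enorm_sq_fourier_Lp_eq fhL, hF, ← lintegral_indicator hs.compl]
    refine lintegral_congr_ae ?_
    filter_upwards [Lp.coeFn_sub (𝓕 f₂ : Lp F 2 (volume : Measure V)) P, hPae] with ξ hξ hPξ
    rw [hξ, Pi.sub_apply, hPξ]
    have hind : G ξ - gl ξ = sᶜ.indicator G ξ := by
      rw [sub_eq_iff_eq_add', hgl_def, Set.indicator_self_add_compl_apply]
    rw [← hG_def, hind]
    by_cases hmem : ξ ∈ sᶜ
    · simp [Set.indicator_of_mem hmem]
    · simp [Set.indicator_of_notMem hmem]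
  · have hbound := enorm_fourierInv_toLp_le h1 h2
    have hgl : ∫⁻ ξ, ‖gl ξ‖ₑ = ∫⁻ ξ in s, ‖G ξ‖ₑ := by
      rw [← lintegral_indicator hs]
      refine lintegral_congr fun ξ => ?_
      exact enorm_indicator_eq_indicator_enorm G ξ
    filter_upwards [hbound, Lp.coeFn_sub f₂ fl] with x hx hsubx
    have hfx : (f₂ : V → F) x = (fhL : V → F) x + (fl : V → F) x := by
      rw [hfhL_def, hsubx, Pi.sub_apply, sub_add_cancel]
    rw [hfx]
    calc ‖(fhL : V → F) x + (fl : V → F) x‖ₑ ≤ ‖(fhL : V → F) x‖ₑ + ‖(fl : V → F) x‖ₑ :=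
          enorm_add_le _ _
      _ ≤ ‖(fhL : V → F) x‖ₑ + ∫⁻ ξ in s, ‖G ξ‖ₑ := by
          rw [← hgl]
          gcongr
      _ = _ := add_comm _ _

/-- **Bienaymé–Chebyshev step** (Chemin–Xu 1997, (10)): if `∫_s ‖𝓕f‖ ≤ t/2`, then
`vol{‖f‖ > t} ≤ (t/2)⁻² ∫_{sᶜ} ‖𝓕f‖²`. [cite: CheminXu1997, Introduction (10), pp. 723–724] -/
theorem volume_norm_gt_le (f₂ : Lp F 2 (volume : Measure V)) {s : Set V} (hs : MeasurableSet s)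
    {t : ℝ} (ht : 0 < t)
    (hL : ∫⁻ ξ in s, ‖((𝓕 f₂ : Lp F 2 (volume : Measure V)) : V → F) ξ‖ₑ ≤ ENNReal.ofReal (t / 2)) :
    volume {x | t < ‖(f₂ : V → F) x‖} ≤
      (ENNReal.ofReal (t / 2) ^ 2)⁻¹ *
        ∫⁻ ξ in sᶜ, ‖((𝓕 f₂ : Lp F 2 (volume : Measure V)) : V → F) ξ‖ₑ ^ 2 := by
  have hGs : ∫⁻ ξ in s, ‖((𝓕 f₂ : Lp F 2 (volume : Measure V)) : V → F) ξ‖ₑ < ∞ :=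
    lt_of_le_of_lt hL ENNReal.ofReal_lt_top
  obtain ⟨fh, hfhm, hfh2, hae⟩ := exists_high_frequency_part f₂ hs hGs
  set ε : ℝ≥0∞ := ENNReal.ofReal (t / 2) ^ 2 with hε
  have hε0 : ε ≠ 0 := pow_ne_zero _ (ENNReal.ofReal_pos.2 (by positivity)).ne'
  have hεtop : ε ≠ ∞ := ENNReal.pow_ne_top ENNReal.ofReal_ne_top
  have hsub : {x | t < ‖(f₂ : V → F) x‖} ≤ᵐ[volume] {x | ε ≤ ‖fh x‖ₑ ^ 2} := by
    filter_upwards [hae] with x hx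
    intro (htx : t < ‖(f₂ : V → F) x‖)
    show ε ≤ ‖fh x‖ₑ ^ 2
    have h1 : ENNReal.ofReal t < ENNReal.ofReal (t / 2) + ‖fh x‖ₑ := by
      calc ENNReal.ofReal t < ‖(f₂ : V → F) x‖ₑ := by
            rw [← ofReal_norm]
            exact (ENNReal.ofReal_lt_ofReal_iff (ht.trans htx)).2 htx
        _ ≤ (∫⁻ ξ in s, ‖((𝓕 f₂ : Lp F 2 (volume : Measure V)) : V → F) ξ‖ₑ) + ‖fh x‖ₑ := hx
        _ ≤ ENNReal.ofReal (t / 2) + ‖fh x‖ₑ := by gcongr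
    have h2 : ENNReal.ofReal (t / 2) < ‖fh x‖ₑ := by
      have ht2 : ENNReal.ofReal t = ENNReal.ofReal (t / 2) + ENNReal.ofReal (t / 2) := by
        rw [← ENNReal.ofReal_add (by positivity) (by positivity)]
        congr 1
        ring
      rw [ht2] at h1
      exact (ENNReal.add_lt_add_iff_left ENNReal.ofReal_ne_top).1 h1
    rw [hε]
    gcongr
  calc volume {x | t < ‖(f₂ : V → F) x‖} ≤ volume {x | ε ≤ ‖fh x‖ₑ ^ 2} := measure_mono_ae hsub
    _ ≤ (∫⁻ x, ‖fh x‖ₑ ^ 2) / ε :=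
        meas_ge_le_lintegral_div (hfhm.enorm.pow_const _) hε0 hεtop
    _ = ε⁻¹ * ∫⁻ ξ in sᶜ, ‖((𝓕 f₂ : Lp F 2 (volume : Measure V)) : V → F) ξ‖ₑ ^ 2 := by
        rw [hfh2, div_eq_mul_inv, mul_comm]

omit [CompleteSpace F] in
/-- **Fubini–Tonelli step** (Chemin–Xu 1997, end of the proof of (5), p. 724):
`∫_{t>0} ∫_{‖ξ‖ ≥ t/(2m)} H(ξ) dξ dt = 2m ∫ ‖ξ‖ H(ξ) dξ` for `m > 0` and a.e.-measurable
`H ≥ 0`. [cite: CheminXu1997, Introduction, proof of (5), p. 724] -/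
theorem lintegral_Ioi_lintegral_compl_ball {H : V → ℝ≥0∞} (hH : AEMeasurable H volume) {m : ℝ}
    (hm : 0 < m) :
    ∫⁻ t in Ioi (0 : ℝ), ∫⁻ ξ in (Metric.ball (0 : V) (t / (2 * m)))ᶜ, H ξ =
      ENNReal.ofReal (2 * m) * ∫⁻ ξ, ‖ξ‖ₑ * H ξ := by
  set S : Set (ℝ × V) := {p | p.1 ≤ 2 * m * ‖p.2‖} with hS
  have hSm : MeasurableSet S :=
    measurableSet_le measurable_fst ((measurable_snd.norm).const_mul _)
  set Kf : ℝ × V → ℝ≥0∞ := S.indicator fun p => H p.2 with hKf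
  have hKm : AEMeasurable Kf ((volume.restrict (Ioi (0 : ℝ))).prod volume) :=
    (hH.comp_snd).indicator hSm
  have hinner : ∀ t ∈ Ioi (0 : ℝ),
      ∫⁻ ξ in (Metric.ball (0 : V) (t / (2 * m)))ᶜ, H ξ = ∫⁻ ξ, Kf (t, ξ) := by
    intro t _
    rw [← lintegral_indicator measurableSet_ball.compl]
    refine lintegral_congr fun ξ => ?_
    have hiff : ξ ∈ (Metric.ball (0 : V) (t / (2 * m)))ᶜ ↔ (t, ξ) ∈ S := by
      rw [Set.mem_compl_iff, mem_ball_zero_iff, not_lt, hS, Set.mem_setOf_eq,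
        div_le_iff₀ (by positivity), mul_comm]
    by_cases hξ : ξ ∈ (Metric.ball (0 : V) (t / (2 * m)))ᶜ
    · rw [indicator_of_mem hξ, hKf, indicator_of_mem (hiff.1 hξ)]
    · rw [indicator_of_notMem hξ, hKf, indicator_of_notMem (mt hiff.2 hξ)]
  have houter : ∀ ξ : V, ∫⁻ t in Ioi (0 : ℝ), Kf (t, ξ) = H ξ * ENNReal.ofReal (2 * m * ‖ξ‖) := by
    intro ξ
    have hpt : ∀ t : ℝ, Kf (t, ξ) = (Iic (2 * m * ‖ξ‖)).indicator (fun _ => H ξ) t := by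
      intro t
      by_cases ht : t ∈ Iic (2 * m * ‖ξ‖)
      · rw [indicator_of_mem ht, hKf, indicator_of_mem (show (t, ξ) ∈ S from ht)]
      · rw [indicator_of_notMem ht, hKf, indicator_of_notMem (show (t, ξ) ∉ S from ht)]
    simp_rw [hpt]
    rw [lintegral_indicator_const measurableSet_Iic, Measure.restrict_apply measurableSet_Iic,
      Set.Iic_inter_Ioi, Real.volume_Ioc, sub_zero]
  calc ∫⁻ t in Ioi (0 : ℝ), ∫⁻ ξ in (Metric.ball (0 : V) (t / (2 * m)))ᶜ, H ξ
      = ∫⁻ t in Ioi (0 : ℝ), ∫⁻ ξ, Kf (t, ξ) := setLIntegral_congr_fun measurableSet_Ioi hinner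
    _ = ∫⁻ ξ, ∫⁻ t in Ioi (0 : ℝ), Kf (t, ξ) :=
        lintegral_lintegral_swap (f := fun t ξ => Kf (t, ξ))
          (by
            have huc : (Function.uncurry fun t ξ => Kf (t, ξ)) = Kf := by
              funext p
              rfl
            rw [huc]
            exact hKm)
    _ = ∫⁻ ξ, H ξ * ENNReal.ofReal (2 * m * ‖ξ‖) := lintegral_congr houter
    _ = ∫⁻ ξ, ENNReal.ofReal (2 * m) * (‖ξ‖ₑ * H ξ) := by
        refine lintegral_congr fun ξ => ?_
        rw [ENNReal.ofReal_mul (by positivity), ofReal_norm]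
        ring
    _ = ENNReal.ofReal (2 * m) * ∫⁻ ξ, ‖ξ‖ₑ * H ξ :=
        lintegral_const_mul' _ _ ENNReal.ofReal_ne_top

/-- **Layer-cake step** (Chemin–Xu 1997, proof of (5) with `p = 3`): if for every `t > 0` the
distribution function of `f ∈ L²` satisfies `vol{‖f‖ > t} ≤ (t/2)⁻² ∫_{‖ξ‖ ≥ t/(2m)} ‖𝓕f‖²`,
then `∫ ‖f‖³ = 3 ∫₀^∞ t² vol{‖f‖ > t} dt ≤ 24 m ∫ ‖ξ‖ ‖𝓕f(ξ)‖² dξ` (Mathlib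
`lintegral_rpow_eq_lintegral_meas_lt_mul` and the Tonelli step).
[cite: CheminXu1997, Introduction, proof of (5), pp. 723–724] -/
theorem lintegral_enorm_rpow_three_le (f₂ : Lp F 2 (volume : Measure V)) {m : ℝ} (hm : 0 < m)
    (hdist : ∀ t : ℝ, 0 < t → volume {x | t < ‖(f₂ : V → F) x‖} ≤
      (ENNReal.ofReal (t / 2) ^ 2)⁻¹ *
        ∫⁻ ξ in (Metric.ball (0 : V) (t / (2 * m)))ᶜ,
          ‖((𝓕 f₂ : Lp F 2 (volume : Measure V)) : V → F) ξ‖ₑ ^ 2) :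
    ∫⁻ x, ‖(f₂ : V → F) x‖ₑ ^ (3 : ℝ) ≤
      ENNReal.ofReal (24 * m) *
        ∫⁻ ξ, ‖ξ‖ₑ * ‖((𝓕 f₂ : Lp F 2 (volume : Measure V)) : V → F) ξ‖ₑ ^ 2 := by
  set G : V → F := ((𝓕 f₂ : Lp F 2 (volume : Measure V)) : V → F) with hG_def
  have hGm : AEStronglyMeasurable G volume := Lp.aestronglyMeasurable _
  -- layer cake
  have hlc := lintegral_rpow_eq_lintegral_meas_lt_mul volume
    (f := fun x => ‖(f₂ : V → F) x‖) (Eventually.of_forall fun x => norm_nonneg _)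
    (Lp.aestronglyMeasurable f₂).norm.aemeasurable (p := 3) (by norm_num)
  have hlhs : ∫⁻ x, ‖(f₂ : V → F) x‖ₑ ^ (3 : ℝ) = ∫⁻ x, ENNReal.ofReal (‖(f₂ : V → F) x‖ ^ (3 : ℝ)) := by
    refine lintegral_congr fun x => ?_
    rw [← ofReal_norm, ENNReal.ofReal_rpow_of_nonneg (norm_nonneg _) (by norm_num)]
  rw [hlhs, hlc]
  -- pointwise bound of the integrand in `t`
  have hpt : ∀ t ∈ Ioi (0 : ℝ),
      volume {x | t < ‖(f₂ : V → F) x‖} * ENNReal.ofReal (t ^ ((3 : ℝ) - 1)) ≤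
        4 * ∫⁻ ξ in (Metric.ball (0 : V) (t / (2 * m)))ᶜ, ‖G ξ‖ₑ ^ 2 := by
    intro t ht
    have ht' : (0 : ℝ) < t := ht
    have h4 : (ENNReal.ofReal (t / 2) ^ 2)⁻¹ * ENNReal.ofReal (t ^ ((3 : ℝ) - 1)) = 4 := by
      rw [show (3 : ℝ) - 1 = 2 by norm_num, Real.rpow_two, ← ENNReal.ofReal_pow (by positivity),
        ← ENNReal.ofReal_inv_of_pos (by positivity), ← ENNReal.ofReal_mul (by positivity)]
      rw [show ((t / 2) ^ 2)⁻¹ * t ^ 2 = (4 : ℝ) by field_simp; ring]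
      norm_num
    calc volume {x | t < ‖(f₂ : V → F) x‖} * ENNReal.ofReal (t ^ ((3 : ℝ) - 1))
        ≤ ((ENNReal.ofReal (t / 2) ^ 2)⁻¹ * ∫⁻ ξ in (Metric.ball (0 : V) (t / (2 * m)))ᶜ,
            ‖G ξ‖ₑ ^ 2) * ENNReal.ofReal (t ^ ((3 : ℝ) - 1)) := by
          gcongr
          exact hdist t ht'
      _ = (ENNReal.ofReal (t / 2) ^ 2)⁻¹ * ENNReal.ofReal (t ^ ((3 : ℝ) - 1)) *
            ∫⁻ ξ in (Metric.ball (0 : V) (t / (2 * m)))ᶜ, ‖G ξ‖ₑ ^ 2 := by ring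
      _ = 4 * ∫⁻ ξ in (Metric.ball (0 : V) (t / (2 * m)))ᶜ, ‖G ξ‖ₑ ^ 2 := by rw [h4]
  have hT := lintegral_Ioi_lintegral_compl_ball (V := V) (H := fun ξ => ‖G ξ‖ₑ ^ 2)
    (hGm.enorm.pow_const _) hm
  calc ENNReal.ofReal 3 * ∫⁻ t in Ioi 0, volume {x | t < ‖(f₂ : V → F) x‖} *
        ENNReal.ofReal (t ^ ((3 : ℝ) - 1))
      ≤ ENNReal.ofReal 3 * ∫⁻ t in Ioi 0,
          4 * ∫⁻ ξ in (Metric.ball (0 : V) (t / (2 * m)))ᶜ, ‖G ξ‖ₑ ^ 2 := by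
        gcongr ENNReal.ofReal 3 * ?_
        exact setLIntegral_mono' measurableSet_Ioi hpt
    _ = ENNReal.ofReal 3 * (4 * (ENNReal.ofReal (2 * m) * ∫⁻ ξ, ‖ξ‖ₑ * ‖G ξ‖ₑ ^ 2)) := by
        rw [lintegral_const_mul' _ _ (by norm_num), hT]
    _ = ENNReal.ofReal (24 * m) * ∫⁻ ξ, ‖ξ‖ₑ * ‖G ξ‖ₑ ^ 2 := by
        rw [← mul_assoc, ← mul_assoc, show (4 : ℝ≥0∞) = ENNReal.ofReal 4 by norm_num,
          ← ENNReal.ofReal_mul (by norm_num), ← ENNReal.ofReal_mul (by norm_num)]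
        congr 2
        ring

end FourierInv

/-! ## Dimension three: `∫_{B(0,A)} ‖ξ‖⁻¹ dξ = A² J₁` and the low-frequency bound -/

section BallThree

/-- `J₁ = ∫_{‖ξ‖<1} ‖ξ‖⁻¹ dξ < ∞` in `ℝ³` (`1 < 3 = dim`; Mathlib
`integrableOn_ball_of_norm_le_rpow`; the version for all radii is
`Literature.Analysis.FunctionSpaces.HomSobolev.lintegral_ball_inv_enorm_lt_top` of `FluidPDE/HomSobolevWeakLimits.lean`, not
imported here to keep the `FunctionSpaces` imports free of `FluidPDE`). [folklore] -/
theorem lintegral_unitBall_inv_enorm_ne_top :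
    (∫⁻ ξ in Metric.ball (0 : EuclideanSpace ℝ (Fin 3)) 1, ‖ξ‖ₑ⁻¹) ≠ ∞ := by
  have hint : IntegrableOn (fun ξ : EuclideanSpace ℝ (Fin 3) => ‖ξ‖⁻¹) (Metric.ball 0 1) volume := by
    refine integrableOn_ball_of_norm_le_rpow (by rw [finrank_euclideanSpace_fin]; norm_num)
      (C := 1) (α := 1) (by rw [finrank_euclideanSpace_fin]; norm_num)
      (Eventually.of_forall fun ξ => ?_) measurable_norm.inv.aestronglyMeasurable
    rw [norm_inv, norm_norm, Real.rpow_neg_one, one_mul]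
  have h : ∫⁻ ξ in Metric.ball (0 : EuclideanSpace ℝ (Fin 3)) 1, ‖(‖ξ‖⁻¹ : ℝ)‖ₑ < ∞ := hint.2
  refine (lt_of_le_of_lt (lintegral_mono_ae ?_) h).ne
  have h0 : ∀ᵐ ξ ∂(volume : Measure (EuclideanSpace ℝ (Fin 3))), ξ ≠ 0 := by
    rw [ae_iff]; simp [measure_singleton]
  filter_upwards [ae_restrict_of_ae h0] with ξ hξ
  rw [Real.enorm_eq_ofReal (inv_nonneg.2 (norm_nonneg ξ)),
    ENNReal.ofReal_inv_of_pos (norm_pos_iff.2 hξ), ofReal_norm]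

/-- `0 < J₁ = ∫_{‖ξ‖<1} ‖ξ‖⁻¹ dξ` (the integrand is `≥ 1` on the unit ball, which has positive
measure). [folklore] -/
theorem lintegral_ball_inv_enorm_pos :
    0 < ∫⁻ ξ in Metric.ball (0 : EuclideanSpace ℝ (Fin 3)) 1, ‖ξ‖ₑ⁻¹ := by
  have h1 : ∫⁻ _ in Metric.ball (0 : EuclideanSpace ℝ (Fin 3)) 1, (1 : ℝ≥0∞) ≤
      ∫⁻ ξ in Metric.ball (0 : EuclideanSpace ℝ (Fin 3)) 1, ‖ξ‖ₑ⁻¹ := by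
    refine setLIntegral_mono' measurableSet_ball fun ξ hξ => ?_
    rw [ENNReal.one_le_inv, ← ofReal_norm, ← ENNReal.ofReal_one]
    exact ENNReal.ofReal_le_ofReal (le_of_lt (by simpa using hξ))
  refine lt_of_lt_of_le ?_ h1
  rw [setLIntegral_const, one_mul]
  exact Metric.measure_ball_pos volume _ one_pos

/-- Scaling in `ℝ³`: `∫_{‖ξ‖<A} ‖ξ‖⁻¹ dξ = A² ∫_{‖ξ‖<1} ‖ξ‖⁻¹ dξ` for `A > 0` (substitution
`ξ = A η`, `dξ = A³ dη`; Mathlib `Measure.map_addHaar_smul`). This is the computation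
`∫_{B(0,A)} ‖ξ‖^{-2s} dξ = C A^{d-2s}` behind (9) of Chemin–Xu 1997 for `d = 3`, `s = 1/2`.
[cite: CheminXu1997, Introduction (9), p. 723] -/
theorem lintegral_ball_inv_enorm_eq {A : ℝ} (hA : 0 < A) :
    ∫⁻ ξ in Metric.ball (0 : EuclideanSpace ℝ (Fin 3)) A, ‖ξ‖ₑ⁻¹ =
      ENNReal.ofReal (A ^ 2) * ∫⁻ ξ in Metric.ball (0 : EuclideanSpace ℝ (Fin 3)) 1, ‖ξ‖ₑ⁻¹ := by
  set h : EuclideanSpace ℝ (Fin 3) → ℝ≥0∞ :=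
    (Metric.ball (0 : EuclideanSpace ℝ (Fin 3)) 1).indicator fun η => ‖η‖ₑ⁻¹ with hh
  have hmeas : Measurable h := measurable_enorm.inv.indicator measurableSet_ball
  have hsm : Measurable fun ξ : EuclideanSpace ℝ (Fin 3) => A⁻¹ • ξ := measurable_id.const_smul A⁻¹
  have hpt : ∀ ξ : EuclideanSpace ℝ (Fin 3),
      (Metric.ball (0 : EuclideanSpace ℝ (Fin 3)) A).indicator (fun ξ => ‖ξ‖ₑ⁻¹) ξ =
        ENNReal.ofReal A⁻¹ * h (A⁻¹ • ξ) := by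
    intro ξ
    have hmem : A⁻¹ • ξ ∈ Metric.ball (0 : EuclideanSpace ℝ (Fin 3)) 1 ↔
        ξ ∈ Metric.ball (0 : EuclideanSpace ℝ (Fin 3)) A := by
      rw [mem_ball_zero_iff, mem_ball_zero_iff, norm_smul, norm_inv, Real.norm_of_nonneg hA.le,
        inv_mul_lt_iff₀ hA, mul_one]
    by_cases hξ : ξ ∈ Metric.ball (0 : EuclideanSpace ℝ (Fin 3)) A
    · rw [indicator_of_mem hξ, hh, indicator_of_mem (hmem.2 hξ), enorm_smul,
        ENNReal.mul_inv (Or.inr enorm_ne_top) (Or.inl enorm_ne_top),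
        Real.enorm_eq_ofReal (inv_nonneg.2 hA.le), ENNReal.ofReal_inv_of_pos hA, inv_inv,
        ← mul_assoc, ENNReal.inv_mul_cancel ((ENNReal.ofReal_pos.2 hA).ne') ENNReal.ofReal_ne_top,
        one_mul]
    · rw [indicator_of_notMem hξ, hh, indicator_of_notMem (mt hmem.1 hξ), mul_zero]
  calc ∫⁻ ξ in Metric.ball (0 : EuclideanSpace ℝ (Fin 3)) A, ‖ξ‖ₑ⁻¹
      = ∫⁻ ξ, (Metric.ball (0 : EuclideanSpace ℝ (Fin 3)) A).indicator (fun ξ => ‖ξ‖ₑ⁻¹) ξ :=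
        (lintegral_indicator measurableSet_ball _).symm
    _ = ∫⁻ ξ, ENNReal.ofReal A⁻¹ * h (A⁻¹ • ξ) := lintegral_congr hpt
    _ = ENNReal.ofReal A⁻¹ * ∫⁻ ξ, h (A⁻¹ • ξ) := lintegral_const_mul _ (hmeas.comp hsm)
    _ = ENNReal.ofReal A⁻¹ *
          ∫⁻ η, h η ∂(Measure.map (fun ξ : EuclideanSpace ℝ (Fin 3) => A⁻¹ • ξ) volume) := by
        rw [lintegral_map hmeas hsm]
    _ = ENNReal.ofReal A⁻¹ * (ENNReal.ofReal (A ^ 3) * ∫⁻ η, h η) := by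
        rw [Measure.map_addHaar_smul volume (inv_ne_zero hA.ne'), lintegral_smul_measure,
          finrank_euclideanSpace_fin, smul_eq_mul, inv_pow, inv_inv, abs_of_pos (pow_pos hA 3)]
    _ = ENNReal.ofReal (A ^ 2) * ∫⁻ ξ in Metric.ball (0 : EuclideanSpace ℝ (Fin 3)) 1, ‖ξ‖ₑ⁻¹ := by
        rw [← mul_assoc, ← ENNReal.ofReal_mul (inv_nonneg.2 hA.le), hh,
          lintegral_indicator measurableSet_ball]
        congr 2
        field_simp

variable {F : Type*} [NormedAddCommGroup F]

/-- Cauchy–Schwarz for the low frequencies (Chemin–Xu 1997, (9)):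
`∫_{‖ξ‖<A} ‖G‖ ≤ (∫_{‖ξ‖<A} ‖ξ‖⁻¹)^{1/2} (∫ ‖ξ‖ ‖G(ξ)‖² dξ)^{1/2}` (Mathlib
`ENNReal.lintegral_mul_le_Lp_mul_Lq`). [cite: CheminXu1997, Introduction (9), p. 723] -/
theorem lintegral_ball_enorm_le {G : EuclideanSpace ℝ (Fin 3) → F}
    (hG : AEStronglyMeasurable G volume) (A : ℝ) :
    ∫⁻ ξ in Metric.ball (0 : EuclideanSpace ℝ (Fin 3)) A, ‖G ξ‖ₑ ≤
      (∫⁻ ξ in Metric.ball (0 : EuclideanSpace ℝ (Fin 3)) A, ‖ξ‖ₑ⁻¹) ^ (1 / 2 : ℝ) *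
        (∫⁻ ξ, ‖ξ‖ₑ * ‖G ξ‖ₑ ^ 2) ^ (1 / 2 : ℝ) := by
  set μ : Measure (EuclideanSpace ℝ (Fin 3)) :=
    volume.restrict (Metric.ball (0 : EuclideanSpace ℝ (Fin 3)) A) with hμ
  have h0 : ∀ᵐ ξ ∂(volume : Measure (EuclideanSpace ℝ (Fin 3))), ξ ≠ 0 := by
    rw [ae_iff]; simp [measure_singleton]
  set a : EuclideanSpace ℝ (Fin 3) → ℝ≥0∞ := fun ξ => ‖ξ‖ₑ⁻¹ ^ (1 / 2 : ℝ) with ha_def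
  set b : EuclideanSpace ℝ (Fin 3) → ℝ≥0∞ := fun ξ => ‖ξ‖ₑ ^ (1 / 2 : ℝ) * ‖G ξ‖ₑ with hb_def
  have ha : AEMeasurable a μ := (measurable_enorm.inv.pow_const _).aemeasurable
  have hb : AEMeasurable b μ :=
    ((measurable_enorm.pow_const _).aemeasurable).mul hG.restrict.enorm
  have h1 : ∫⁻ ξ in Metric.ball (0 : EuclideanSpace ℝ (Fin 3)) A, ‖G ξ‖ₑ = ∫⁻ ξ, (a * b) ξ ∂μ := by
    refine lintegral_congr_ae ((ae_restrict_of_ae h0).mono fun ξ hξ => ?_)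
    have hx0 : (‖ξ‖ₑ : ℝ≥0∞) ≠ 0 := by simpa using hξ
    simp only [ha_def, hb_def, Pi.mul_apply]
    rw [← mul_assoc, ← ENNReal.mul_rpow_of_nonneg _ _ (by norm_num : (0 : ℝ) ≤ 1 / 2),
      ENNReal.inv_mul_cancel hx0 enorm_ne_top, ENNReal.one_rpow, one_mul]
  have h2 := ENNReal.lintegral_mul_le_Lp_mul_Lq μ Real.HolderConjugate.two_two ha hb
  have h3 : ∫⁻ ξ, a ξ ^ (2 : ℝ) ∂μ = ∫⁻ ξ in Metric.ball (0 : EuclideanSpace ℝ (Fin 3)) A, ‖ξ‖ₑ⁻¹ := by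
    refine lintegral_congr fun ξ => ?_
    simp only [ha_def]
    rw [← ENNReal.rpow_mul]
    norm_num
  have h4 : ∫⁻ ξ, b ξ ^ (2 : ℝ) ∂μ ≤ ∫⁻ ξ, ‖ξ‖ₑ * ‖G ξ‖ₑ ^ 2 := by
    calc ∫⁻ ξ, b ξ ^ (2 : ℝ) ∂μ = ∫⁻ ξ in Metric.ball (0 : EuclideanSpace ℝ (Fin 3)) A,
          ‖ξ‖ₑ * ‖G ξ‖ₑ ^ 2 := by
          refine lintegral_congr fun ξ => ?_
          simp only [hb_def]
          rw [ENNReal.mul_rpow_of_nonneg _ _ (by norm_num : (0 : ℝ) ≤ 2), ← ENNReal.rpow_mul]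
          norm_num
      _ ≤ ∫⁻ ξ, ‖ξ‖ₑ * ‖G ξ‖ₑ ^ 2 := setLIntegral_le_lintegral _ _
  rw [h1]
  refine h2.trans ?_
  rw [h3]
  gcongr

/-- Low-frequency bound in dimension `3` (Chemin–Xu 1997, (9) with `d = 3`, `s = 1/2`):
`∫_{‖ξ‖<A} ‖G‖ ≤ A · J₁^{1/2} · (∫ ‖ξ‖ ‖G(ξ)‖² dξ)^{1/2}`, `J₁ = ∫_{‖ξ‖<1} ‖ξ‖⁻¹ dξ`.
[cite: CheminXu1997, Introduction (9), p. 723] -/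
theorem lintegral_ball_enorm_le_mul {G : EuclideanSpace ℝ (Fin 3) → F}
    (hG : AEStronglyMeasurable G volume) {A : ℝ} (hA : 0 < A) :
    ∫⁻ ξ in Metric.ball (0 : EuclideanSpace ℝ (Fin 3)) A, ‖G ξ‖ₑ ≤
      ENNReal.ofReal A * (∫⁻ ξ in Metric.ball (0 : EuclideanSpace ℝ (Fin 3)) 1, ‖ξ‖ₑ⁻¹) ^ (1 / 2 : ℝ) *
        (∫⁻ ξ, ‖ξ‖ₑ * ‖G ξ‖ₑ ^ 2) ^ (1 / 2 : ℝ) := by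
  refine (lintegral_ball_enorm_le hG A).trans (le_of_eq ?_)
  rw [lintegral_ball_inv_enorm_eq hA, ENNReal.mul_rpow_of_nonneg _ _ (by norm_num : (0 : ℝ) ≤ 1 / 2),
    ENNReal.ofReal_rpow_of_nonneg (by positivity) (by norm_num), ← Real.sqrt_eq_rpow,
    Real.sqrt_sq hA.le]

end BallThree

/-! ## Assembly -/

section Main

variable {F : Type*} [NormedAddCommGroup F] [InnerProductSpace ℂ F] [CompleteSpace F]

/-- **The Sobolev inequality `Ḣ^{1/2}(ℝ³) ⊂ L³(ℝ³)` for an `L²` class** (Bahouri–Chemin–Danchin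
2011, Thm. 1.38 with `d = 3`, `s = 1/2`, `p = 3`; proof of Chemin–Xu 1997, Introduction, (5)
via (8)–(10)): `‖f‖_{L³} ≤ (24 J₁^{1/2})^{1/3} (∫ ‖ξ‖ ‖𝓕f(ξ)‖² dξ)^{1/2}` for every
`f ∈ L²(ℝ³; F)`, `J₁ = ∫_{‖ξ‖<1} ‖ξ‖⁻¹ dξ`; with the cut-off `A_t = t / (2 J₁^{1/2} ‖f‖_{Ḣ^{1/2}})`
at level `t`. [cite: BahouriCheminDanchin2011, Thm. 1.38] -/
theorem eLpNorm_three_le_const_mul (f₂ : Lp F 2 (volume : Measure (EuclideanSpace ℝ (Fin 3)))) :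
    eLpNorm (f₂ : EuclideanSpace ℝ (Fin 3) → F) 3 volume ≤
      (24 * (∫⁻ ξ in Metric.ball (0 : EuclideanSpace ℝ (Fin 3)) 1, ‖ξ‖ₑ⁻¹) ^ (1 / 2 : ℝ)) ^ (1 / 3 : ℝ) *
        (∫⁻ ξ, ‖ξ‖ₑ * ‖((𝓕 f₂ : Lp F 2 (volume : Measure (EuclideanSpace ℝ (Fin 3)))) :
          EuclideanSpace ℝ (Fin 3) → F) ξ‖ₑ ^ 2) ^ (1 / 2 : ℝ) := by
  set G : EuclideanSpace ℝ (Fin 3) → F :=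
    ((𝓕 f₂ : Lp F 2 (volume : Measure (EuclideanSpace ℝ (Fin 3)))) : EuclideanSpace ℝ (Fin 3) → F)
    with hG_def
  have hGm : AEStronglyMeasurable G volume := Lp.aestronglyMeasurable _
  set I : ℝ≥0∞ := ∫⁻ ξ, ‖ξ‖ₑ * ‖G ξ‖ₑ ^ 2 with hI_def
  set J : ℝ≥0∞ := ∫⁻ ξ in Metric.ball (0 : EuclideanSpace ℝ (Fin 3)) 1, ‖ξ‖ₑ⁻¹ with hJ_def
  set c : ℝ≥0∞ := J ^ (1 / 2 : ℝ) with hc_def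
  have hJ0 : J ≠ 0 := lintegral_ball_inv_enorm_pos.ne'
  have hJtop : J ≠ ∞ := lintegral_unitBall_inv_enorm_ne_top
  have hc0 : c ≠ 0 := by
    rw [hc_def]
    exact (ENNReal.rpow_pos (pos_iff_ne_zero.2 hJ0) hJtop).ne'
  have hctop : c ≠ ∞ := ENNReal.rpow_ne_top_of_nonneg (by norm_num) hJtop
  have hC0 : (24 * c) ^ (1 / 3 : ℝ) ≠ 0 :=
    (ENNReal.rpow_pos (pos_iff_ne_zero.2 (mul_ne_zero (by norm_num) hc0))
      (ENNReal.mul_ne_top (by norm_num) hctop)).ne'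
  have h0 : ∀ᵐ ξ ∂(volume : Measure (EuclideanSpace ℝ (Fin 3))), ξ ≠ 0 := by
    rw [ae_iff]; simp [measure_singleton]
  rcases eq_or_ne I 0 with hI0 | hI0
  · -- `𝓕 f = 0`, hence `f = 0`
    have hae : (fun ξ => ‖ξ‖ₑ * ‖G ξ‖ₑ ^ 2) =ᵐ[volume] 0 :=
      (lintegral_eq_zero_iff' ((measurable_enorm.aemeasurable).mul (hGm.enorm.pow_const _))).1 hI0
    have hG0 : G =ᵐ[volume] 0 := by
      filter_upwards [hae, h0] with ξ hξ hξ0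
      have hx0 : (‖ξ‖ₑ : ℝ≥0∞) ≠ 0 := by simpa using hξ0
      have h1 : ‖G ξ‖ₑ ^ 2 = 0 := by simpa [hx0] using hξ
      simpa using h1
    have hF0 : (𝓕 f₂ : Lp F 2 (volume : Measure (EuclideanSpace ℝ (Fin 3)))) = 0 :=
      Lp.ext (hG0.trans (Lp.coeFn_zero F 2 volume).symm)
    have hf0 : f₂ = 0 :=
      (Lp.fourierTransformₗᵢ (EuclideanSpace ℝ (Fin 3)) F).injective
        (hF0.trans (map_zero (Lp.fourierTransformₗᵢ (EuclideanSpace ℝ (Fin 3)) F)).symm)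
    have : eLpNorm (f₂ : EuclideanSpace ℝ (Fin 3) → F) 3 volume = 0 := by
      rw [hf0, eLpNorm_congr_ae (Lp.coeFn_zero F 2 volume), eLpNorm_zero]
    rw [this]
    exact zero_le
  rcases eq_or_ne I ∞ with hItop | hItop
  · rw [hItop, ENNReal.top_rpow_of_pos (by norm_num), ENNReal.mul_top hC0]
    exact le_top
  -- main case `0 < I < ∞`
  set K : ℝ≥0∞ := I ^ (1 / 2 : ℝ) with hK_def
  have hK0 : K ≠ 0 := (ENNReal.rpow_pos (pos_iff_ne_zero.2 hI0) hItop).ne'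
  have hKtop : K ≠ ∞ := ENNReal.rpow_ne_top_of_nonneg (by norm_num) hItop
  have hK2 : K ^ 2 = I := by
    rw [hK_def, ← ENNReal.rpow_natCast, ← ENNReal.rpow_mul]
    norm_num
  set m : ℝ := (c * K).toReal with hm_def
  have hm0 : 0 < m := ENNReal.toReal_pos (mul_ne_zero hc0 hK0) (ENNReal.mul_ne_top hctop hKtop)
  have hcK : ENNReal.ofReal m = c * K := ENNReal.ofReal_toReal (ENNReal.mul_ne_top hctop hKtop)
  have hdist : ∀ t : ℝ, 0 < t → volume {x | t < ‖(f₂ : EuclideanSpace ℝ (Fin 3) → F) x‖} ≤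
      (ENNReal.ofReal (t / 2) ^ 2)⁻¹ *
        ∫⁻ ξ in (Metric.ball (0 : EuclideanSpace ℝ (Fin 3)) (t / (2 * m)))ᶜ, ‖G ξ‖ₑ ^ 2 := by
    intro t ht
    have hA : 0 < t / (2 * m) := by positivity
    refine volume_norm_gt_le f₂ measurableSet_ball ht ?_
    calc ∫⁻ ξ in Metric.ball (0 : EuclideanSpace ℝ (Fin 3)) (t / (2 * m)), ‖G ξ‖ₑ
        ≤ ENNReal.ofReal (t / (2 * m)) * c * K := lintegral_ball_enorm_le_mul hGm hA
      _ = ENNReal.ofReal (t / 2) := by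
          rw [mul_assoc, ← hcK, ← ENNReal.ofReal_mul (by positivity)]
          congr 1
          field_simp
  have h3 := lintegral_enorm_rpow_three_le f₂ hm0 hdist
  have h24 : ENNReal.ofReal (24 * m) * I = 24 * c * K ^ 3 := by
    rw [ENNReal.ofReal_mul (by norm_num), hcK, show ENNReal.ofReal 24 = 24 by norm_num,
      pow_succ, ← hK2]
    ring
  rw [h24] at h3
  have hp : eLpNorm (f₂ : EuclideanSpace ℝ (Fin 3) → F) 3 volume =
      (∫⁻ x, ‖(f₂ : EuclideanSpace ℝ (Fin 3) → F) x‖ₑ ^ (3 : ℝ)) ^ (1 / 3 : ℝ) := by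
    rw [eLpNorm_eq_lintegral_rpow_enorm_toReal (by norm_num) (by norm_num)]
    norm_num
  rw [hp]
  calc (∫⁻ x, ‖(f₂ : EuclideanSpace ℝ (Fin 3) → F) x‖ₑ ^ (3 : ℝ)) ^ (1 / 3 : ℝ)
      ≤ (24 * c * K ^ 3) ^ (1 / 3 : ℝ) := by gcongr
    _ = (24 * c) ^ (1 / 3 : ℝ) * K := by
        rw [ENNReal.mul_rpow_of_nonneg _ _ (by norm_num : (0 : ℝ) ≤ 1 / 3)]
        congr 1
        rw [one_div]
        exact_mod_cast ENNReal.pow_rpow_inv_natCast (n := 3) (by norm_num) K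

end Main

end SobolevEmbeddingHalf

/-- **Discharge** of the named fact `eLpNorm_three_le_eHomSobolevSeminorm_half`
(`FourierSobolevNorm.lean`; Bahouri–Chemin–Danchin 2011, Thm. 1.38 with `d = 3`, `s = 1/2`,
`p = 2d/(d-2s) = 3`): there is `C` with `‖f‖_{L³(ℝ³)} ≤ C ‖f‖_{Ḣ^{1/2}(ℝ³)}` for every
`f ∈ L²(ℝ³; F)`; here `C = (24 J₁^{1/2})^{1/3}`, `J₁ = ∫_{‖ξ‖<1} ‖ξ‖⁻¹ dξ`
(`SobolevEmbeddingHalf.eLpNorm_three_le_const_mul`, the frequency-splitting proof of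
Chemin–Xu 1997). [cite: BahouriCheminDanchin2011, Thm. 1.38] -/
theorem eLpNorm_three_le_eHomSobolevSeminorm_half_holds :
    eLpNorm_three_le_eHomSobolevSeminorm_half := by
  intro F _ _ _
  have hJtop : (∫⁻ ξ in Metric.ball (0 : EuclideanSpace ℝ (Fin 3)) 1, ‖ξ‖ₑ⁻¹) ≠ ∞ :=
    SobolevEmbeddingHalf.lintegral_unitBall_inv_enorm_ne_top
  have hCtop : (24 * (∫⁻ ξ in Metric.ball (0 : EuclideanSpace ℝ (Fin 3)) 1, ‖ξ‖ₑ⁻¹) ^ (1 / 2 : ℝ)) ^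
      (1 / 3 : ℝ) ≠ ∞ :=
    ENNReal.rpow_ne_top_of_nonneg (by norm_num)
      (ENNReal.mul_ne_top (by norm_num) (ENNReal.rpow_ne_top_of_nonneg (by norm_num) hJtop))
  refine ⟨((24 * (∫⁻ ξ in Metric.ball (0 : EuclideanSpace ℝ (Fin 3)) 1, ‖ξ‖ₑ⁻¹) ^ (1 / 2 : ℝ)) ^
      (1 / 3 : ℝ)).toNNReal, fun f hf => ?_⟩
  rw [ENNReal.coe_toNNReal hCtop, Function.eHomSobolevSeminorm, dif_pos hf, Literature.Analysis.FunctionSpaces.eHomSobolevSeminorm]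
  have h := SobolevEmbeddingHalf.eLpNorm_three_le_const_mul (hf.toLp f)
  rw [eLpNorm_congr_ae hf.coeFn_toLp] at h
  convert h using 4
  funext ξ
  norm_num

end Literature.Analysis.FunctionSpaces
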